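import Literature.Computability.QuantumComplexity.ForrelationMemSpec
import Literature.Computability.QuantumComplexity.Forrelation
import Literature.Computability.Complexity.CircuitSemantics
import Literature.Computability.Complexity.ListBricks
import HarnessLib

/-!
# Explicit `k`-fold Forrelation is in `PromiseBQP`, V: correctness of the evaluator on genuine codes

Fifth file of the instantiation. On the code `x = ⟨bin n, ⟨bin k, [C₀, …, C_{k-1}]⟩⟩` of an instance
(`KForrelationInstance.encode`, `Forrelation.lean`) the models of `ForrelationMemLists.lean` /
`ForrelationMemEval.lean` compute what they should:

* the occurrence list is the list of input wires read by the circuits (`occAll_encode`), so the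
  list `R` of distinct read wires has pairwise distinct values `< n` (`Rl`, `rank`);
* a wire code reads the wire's value (`wireBit_encodeWire`, for the assignment `assign u` that gives
  input `i` the bit of the register at the rank of `i`); the halving of a truth table along the
  arguments from the last to the first selects the entry of the gate function (`truthTable_snoc`,
  `tableSelect_truthTable`), so a gate code evaluates to the gate's value (`gateBitM_encodeGate`),
  the gate fold is the transcript (`evalGatesM_encode`, `CircuitSemantics.transcript`), and **the
  phase bit of layer `j` on register `u` is `[1 ≤ j ≤ k] ∧ C_{j-1}(assign u)`** (`phaseBitM_encode`);
* circuits only read their read wires (`Circuit.eval_congr_reads`).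

## References

* S. Aaronson, A. Ambainis, *Forrelation*, SIAM J. Comput. 47 (2018), §6 (p. 26) [AaronsonAmbainis2018].
* S. Arora, B. Barak, *Computational Complexity: A Modern Approach*, CUP 2009, §6.1, Rem. 6.4 and
  Thm. 6.18 (proof) [AroraBarak2009].
-/

noncomputable section

namespace Literature.Computability.QuantumComplexity

open _root_.Computability Complexity Complexity.Brick MetaComplexity

namespace ForrMem

/-! ### Codes -/

section Codes

/-- The list coding of `Forrelation.lean` is the nested-pair coding `encList`. [folklore] -/
theorem encodeCodeList_eq_encList : ∀ l : List (List Bool), encodeCodeList l = encList l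
  | [] => rfl
  | a :: l => by rw [encodeCodeList, List.foldr_cons, ← encodeCodeList, encodeCodeList_eq_encList l, encList_cons]

variable {n : ℕ}

/-- The index of an input wire (nothing for a gate reference). [folklore] -/
def inlIdx : Fin n ⊕ ℕ → List ℕ
  | .inl i => [i.val]
  | .inr _ => []

/-- Occurrences in a wire code. [folklore] -/
theorem occW_encodeWire (w : Fin n ⊕ ℕ) : occW (encodeWire n w) = (inlIdx w).map encodeNat := by
  cases w <;> simp [occW, encodeWire, inlIdx]

/-- The input wires read by a gate, in order. [folklore] -/
def readsG (g : Gate (Fin n)) : List ℕ := (List.ofFn g.args).flatMap inlIdx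

/-- Occurrences in a gate code. [folklore] -/
theorem occG_encodeGate (g : Gate (Fin n)) : occG (encodeGate g) = (readsG g).map encodeNat := by
  rw [occG, encodeGate, sndF_boolPair, encodeCodeList_eq_encList, decNil_encList, readsG,
    show (List.ofFn fun a => encodeWire n (g.args a)) = (List.ofFn g.args).map (encodeWire n) by rw [List.map_ofFn]; rfl,
    List.flatMap_map, List.map_flatMap]
  simp only [occW_encodeWire]

/-- The input wires read by a circuit: the arguments of the gates in order, then the output. [folklore] -/
def readsC (C : Circuit (Fin n)) : List ℕ := C.gates.flatMap readsG ++ inlIdx C.output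

/-- Occurrences in a circuit code. [folklore] -/
theorem occC_encodeCircuit (C : Circuit (Fin n)) : occC (encodeCircuit C) = (readsC C).map encodeNat := by
  rw [occC, encodeCircuit, fstF_boolPair, sndF_boolPair, encodeCodeList_eq_encList, decNil_encList, readsC, List.map_append,
    occW_encodeWire, List.flatMap_map, List.map_flatMap]
  simp only [occG_encodeGate]

/-- The input wires read by an instance: circuit by circuit. [folklore] -/
def occList (I : KForrelationInstance) : List ℕ := (List.ofFn fun i => readsC (I.C i)).flatMap fun l => l

/-- The list of circuit codes of an instance. [folklore] -/
theorem sndF_sndF_encode (I : KForrelationInstance) :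
    sndF (sndF I.encode) = encList (List.ofFn fun i => encodeCircuit (I.C i)) ∧ fstF I.encode = encodeNat I.n ∧
      fstF (sndF I.encode) = encodeNat I.k := by
  simp [KForrelationInstance.encode, encodeCodeList_eq_encList]

/-- **Occurrences in an instance code.** [folklore] -/
theorem occAll_encode (I : KForrelationInstance) : occAll (sndF (sndF I.encode)) = (occList I).map encodeNat := by
  rw [(sndF_sndF_encode I).1, occAll, decNil_encList, occList,
    show (List.ofFn fun i => encodeCircuit (I.C i)) = (List.ofFn fun i => I.C i).map encodeCircuit by rw [List.map_ofFn]; rfl,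
    List.flatMap_map, List.map_flatMap,
    show (List.ofFn fun i => readsC (I.C i)) = (List.ofFn fun i => I.C i).map readsC by rw [List.map_ofFn]; rfl,
    List.flatMap_map]
  simp only [occC_encodeCircuit]

/-- Every read wire is an input index `< n`. [folklore] -/
theorem lt_of_mem_occList (I : KForrelationInstance) {v : ℕ} (hv : v ∈ occList I) : v < I.n := by
  simp only [occList, List.mem_flatMap, List.mem_ofFn] at hv
  obtain ⟨l, ⟨t, rfl⟩, hv⟩ := hv
  simp only [readsC, List.mem_append, List.mem_flatMap, readsG, List.mem_ofFn] at hv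
  rcases hv with ⟨g, -, w, ⟨a, rfl⟩, hw⟩ | hw
  · cases h : (I.C t).gates[0]? with | _ => ?_
    all_goals
      revert hw; cases g.args a <;> simp [inlIdx]
      rintro rfl; exact Fin.isLt _
  · revert hw; cases (I.C t).output <;> simp [inlIdx]
    rintro rfl; exact Fin.isLt _

end Codes

/-! ### The distinct read wires and the rank -/

section Rank

variable (I : KForrelationInstance)

/-- **The list `R` of distinct read wires** (as numerals), in order of first occurrence. [folklore] -/
def Rl : List (List Bool) := dedupVals ((occList I).map encodeNat)

/-- The model computes `Rl`. [folklore] -/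
theorem dedupVals_occAll_encode : dedupVals (occAll (sndF (sndF I.encode))) = Rl I := by rw [occAll_encode, Rl]

/-- The values of `Rl` are the read wires. [folklore] -/
theorem mem_Rl_values_iff (v : ℕ) : v ∈ (Rl I).map bitsToNat ↔ v ∈ occList I := by
  rw [Rl, mem_map_dedupVals_iff, List.map_map]
  simp [Function.comp_def]

/-- The values of `Rl` are pairwise distinct. [folklore] -/
theorem nodup_Rl_values : ((Rl I).map bitsToNat).Nodup := nodup_map_dedupVals _

/-- `#R ≤ n`: the values are distinct indices `< n`. [folklore] -/
theorem length_Rl_le : (Rl I).length ≤ I.n := by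
  have h1 : ((Rl I).map bitsToNat).toFinset ⊆ Finset.range I.n := fun v hv =>
    Finset.mem_range.2 (lt_of_mem_occList I ((mem_Rl_values_iff I v).1 (List.mem_toFinset.1 hv)))
  have h2 := Finset.card_le_card h1
  rw [List.toFinset_card_of_nodup (nodup_Rl_values I), List.length_map, Finset.card_range] at h2
  exact h2

/-- **The rank of input wire `i`**: the position of `i` in `R` (`#R` if unread). [folklore] -/
def rank (i : Fin I.n) : ℕ := rankIdx (encodeNat i.val) (Rl I)

/-- `rank i ≤ #R`. [folklore] -/
theorem rank_le (i : Fin I.n) : rank I i ≤ (Rl I).length := by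
  rw [rank, rankIdx]; exact List.findIdx_le_length

/-- A read wire has rank `< #R`. [folklore] -/
theorem rank_lt_of_mem {i : Fin I.n} (h : i.val ∈ occList I) : rank I i < (Rl I).length :=
  rankIdx_lt_length (by rw [bitsToNat_encodeNat]; exact (mem_Rl_values_iff I i.val).2 h)

/-- A wire of rank `< #R` is read, and the item at its rank has its value. [folklore] -/
theorem value_at_rank {i : Fin I.n} (h : rank I i < (Rl I).length) : bitsToNat ((Rl I)[rank I i]) = i.val := by
  have := bitsToNat_getElem_rankIdx (qn := encodeNat i.val) (l := Rl I) h
  rwa [bitsToNat_encodeNat] at this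

/-- The rank is injective on read wires. [folklore] -/
theorem rank_injOn {i i' : Fin I.n} (hi : rank I i < (Rl I).length) (h : rank I i = rank I i') : i = i' := by
  have h1 := value_at_rank I hi
  have hi' : rank I i' < (Rl I).length := h ▸ hi
  have h2 := value_at_rank I hi'
  simp only [h] at h1
  exact Fin.ext (h1.symm.trans h2)

/-- If all `n` wires' worth of values are present (`#R = n`), every wire is read. [folklore] -/
theorem rank_lt_of_length_eq (hn : (Rl I).length = I.n) (i : Fin I.n) : rank I i < (Rl I).length := by
  apply rank_lt_of_mem
  rw [← mem_Rl_values_iff]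
  -- the `n` distinct values `< n` exhaust `range n`
  have h1 : ((Rl I).map bitsToNat).toFinset ⊆ Finset.range I.n := fun v hv =>
    Finset.mem_range.2 (lt_of_mem_occList I ((mem_Rl_values_iff I v).1 (List.mem_toFinset.1 hv)))
  have h2 : ((Rl I).map bitsToNat).toFinset.card = (Finset.range I.n).card := by
    rw [List.toFinset_card_of_nodup (nodup_Rl_values I), List.length_map, Finset.card_range, hn]
  have h3 := Finset.eq_of_subset_of_card_le h1 h2.ge
  rw [← List.mem_toFinset, h3]
  exact Finset.mem_range.2 i.isLt

/-- **The assignment read off a register content `u`**: input `i` gets the bit at position `rank i`. [folklore] -/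
def assign (u : List Bool) (i : Fin I.n) : Bool := u.getD (rank I i) false

end Rank

/-! ### Wires, truth tables, gates, transcripts -/

section Eval

variable (I : KForrelationInstance)

/-- **A wire code reads the wire's value.** [cite: AroraBarak2009, Thm. 6.18 (proof)] -/
theorem wireBit_encodeWire (u V : List Bool) (w : Fin I.n ⊕ ℕ) :
    wireBit (Rl I) u V (encodeWire I.n w) = wireVal (assign I u) V w := by
  cases w with
  | inl i => simp [wireBit, encodeWire, wireVal, assign, rank]
  | inr m => simp [wireBit, encodeWire, wireVal]

/-- The index of an assignment in the enumeration `boolFunEquivFin`: `∑ⱼ [vⱼ] 2ʲ`. [folklore] -/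
theorem boolFunEquivFin_val {a : ℕ} (v : Fin a → Bool) : ((boolFunEquivFin a v : Fin (2 ^ a)) : ℕ) = ∑ j : Fin a, (v j).toNat * 2 ^ (j : ℕ) := by
  rw [boolFunEquivFin, Equiv.trans_apply, finFunctionFinEquiv_apply]
  refine Finset.sum_congr rfl fun j _ => ?_
  simp only [Equiv.arrowCongr_apply, Equiv.refl_symm, Equiv.coe_refl, Function.comp_apply, id_eq]
  cases v j <;> rfl

/-- The index of `Fin.snoc w b`: `index w + [b] 2ᵃ`. [folklore] -/
theorem boolFunEquivFin_snoc_val {a : ℕ} (w : Fin a → Bool) (b : Bool) :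
    ((boolFunEquivFin (a + 1) (Fin.snoc w b) : Fin (2 ^ (a + 1))) : ℕ) = (boolFunEquivFin a w : ℕ) + b.toNat * 2 ^ a := by
  rw [boolFunEquivFin_val, boolFunEquivFin_val, Fin.sum_univ_castSucc]
  simp

/-- The entry of the truth table at the index of `v` is `f v`. [folklore] -/
theorem truthTable_getElem {a : ℕ} (f : (Fin a → Bool) → Bool) (v : Fin a → Bool) {i : ℕ}
    (hi : i = ((boolFunEquivFin a v : Fin (2 ^ a)) : ℕ)) (h : i < (truthTable f).length) : (truthTable f)[i] = f v := by
  subst hi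
  simp [truthTable]

/-- **The two halves of a truth table** are the truth tables of the two restrictions of the last
argument. [folklore] -/
theorem truthTable_snoc {a : ℕ} (f : (Fin (a + 1) → Bool) → Bool) :
    truthTable f = truthTable (fun w => f (Fin.snoc w false)) ++ truthTable (fun w => f (Fin.snoc w true)) := by
  apply List.ext_getElem
  · simp [pow_succ]; ring
  intro i h1 h2
  rw [length_truthTable] at h1
  rcases Nat.lt_or_ge i (2 ^ a) with hi | hi
  · set w := (boolFunEquivFin a).symm ⟨i, hi⟩ with hw
    have hiw : i = (boolFunEquivFin a w : ℕ) := by rw [hw, Equiv.apply_symm_apply]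
    have e : i = (boolFunEquivFin (a + 1) (Fin.snoc w false) : ℕ) := by rw [boolFunEquivFin_snoc_val, ← hiw]; simp
    rw [List.getElem_append_left (by simpa using hi), truthTable_getElem f _ e, truthTable_getElem _ w hiw]
  · have hi' : i - 2 ^ a < 2 ^ a := by rw [pow_succ] at h1; omega
    set w := (boolFunEquivFin a).symm ⟨i - 2 ^ a, hi'⟩ with hw
    have hiw : i - 2 ^ a = (boolFunEquivFin a w : ℕ) := by rw [hw, Equiv.apply_symm_apply]
    have e : i = (boolFunEquivFin (a + 1) (Fin.snoc w true) : ℕ) := by rw [boolFunEquivFin_snoc_val, ← hiw]; simp; omega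
    rw [List.getElem_append_right (by simpa using hi), truthTable_getElem f _ e]
    simp only [length_truthTable]
    rw [truthTable_getElem _ w hiw]

/-- One halving step on a truth table restricts the last argument. [folklore] -/
theorem halveStep_truthTable {a : ℕ} (f : (Fin (a + 1) → Bool) → Bool) (b : Bool) :
    halveStep (truthTable f) b = truthTable fun w => f (Fin.snoc w b) := by
  rw [halveStep, length_truthTable, truthTable_snoc f, show 2 ^ (a + 1) / 2 = 2 ^ a by rw [pow_succ]; omega]
  cases b
  · simp [List.take_left']
  · simp [List.drop_left']

/-- **Table selection evaluates the function**: halving along the arguments from the last to the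
first leaves the entry `f v`. [cite: AroraBarak2009, Thm. 6.18 (proof)] -/
theorem tableSelect_truthTable : ∀ {a : ℕ} (f : (Fin a → Bool) → Bool) (v : Fin a → Bool),
    (tableSelect (truthTable f) (List.ofFn v).reverse).headD false = f v
  | 0, f, v => by
    have hv : v = Fin.elim0 := funext fun i => i.elim0
    simp [tableSelect, truthTable, hv, Subsingleton.elim ((boolFunEquivFin 0).symm 0) Fin.elim0]
  | a + 1, f, v => by
    rw [List.ofFn_succ', List.concat_eq_append, List.reverse_append, List.reverse_singleton, List.singleton_append, tableSelect,
      List.foldl_cons, halveStep_truthTable, ← tableSelect,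
      tableSelect_truthTable (fun w => f (Fin.snoc w (v (Fin.last a)))) (fun i => v i.castSucc)]
    congr 1
    exact Fin.snoc_init_self v

/-- **A gate code evaluates to the gate's value.** [cite: AroraBarak2009, Thm. 6.18 (proof)] -/
theorem gateBitM_encodeGate (u V : List Bool) (g : Gate (Fin I.n)) :
    gateBitM (Rl I) u V (encodeGate g) = gateValue (assign I u) V g := by
  rw [gateBitM, encodeGate, fstF_boolPair, sndF_boolPair, encodeCodeList_eq_encList, decNil_encList, gateValue, List.map_reverse,
    List.map_ofFn]
  have : (wireBit (Rl I) u V ∘ fun a => encodeWire I.n (g.args a)) = fun a => wireVal (assign I u) V (g.args a) :=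
    funext fun a => wireBit_encodeWire I u V (g.args a)
  rw [this, tableSelect_truthTable]

/-- **The gate fold is the transcript.** [cite: AroraBarak2009, Rem. 6.4] -/
theorem evalGatesM_map_encodeGate (u : List Bool) (gs : List (Gate (Fin I.n))) :
    evalGatesM (Rl I) u (gs.map encodeGate) = transcript (assign I u) [] gs := by
  rw [evalGatesM, transcript, List.foldl_map]
  exact congrArg₂ (List.foldl · · gs) (funext fun V => funext fun g => by rw [gateBitM_encodeGate]) rfl

/-- Circuit `j` of the instance (`1 ≤ j ≤ k`) in the list of codes. [folklore] -/
theorem circuit_select {j : ℕ} (hj1 : 1 ≤ j) (hjk : j ≤ I.k) :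
    fstF (sndF^[j - 1] (sndF (sndF I.encode))) = encodeCircuit (I.C ⟨j - 1, by omega⟩) := by
  rw [(sndF_sndF_encode I).1, sndF_iterate_encList, fstF_encList, List.drop_eq_getElem_cons (by simp; omega)]
  simp

/-- **The phase bit on an instance code**: `[1 ≤ j ≤ k] ∧ C_{j-1}(assign u)`.
[cite: AaronsonAmbainis2018, §6 (p. 26: simulate each query by running the circuit)] -/
theorem phaseBitM_encode (u : List Bool) (j : ℕ) :
    phaseBitM I.encode u j = (decide (1 ≤ j) && decide (j ≤ I.k) &&
      if h : 1 ≤ j ∧ j ≤ I.k then (I.C ⟨j - 1, by omega⟩).eval (assign I u) else false) := by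
  rw [phaseBitM]
  simp only [dedupVals_occAll_encode, (sndF_sndF_encode I).2.2, unLeBinFn_boolPair]
  by_cases hj1 : 1 ≤ j
  · by_cases hjk : j ≤ I.k
    · rw [dif_pos ⟨hj1, hjk⟩, circuit_select I hj1 hjk, encodeCircuit, fstF_boolPair, sndF_boolPair, encodeCodeList_eq_encList,
        decNil_encList, evalGatesM_map_encodeGate, wireBit_encodeWire, eval_eq_wireVal]
      simp [ones, hj1, hjk]
    · simp [ones, hjk]
  · simp [hj1]

end Eval

/-! ### Circuits only read their read wires -/

section Reads

variable {n : ℕ}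

/-- Transcripts agree when the inputs agree on the wires read by the gates. [folklore] -/
theorem transcript_congr_reads {x x' : Fin n → Bool} : ∀ (gs : List (Gate (Fin n))) (vals : List Bool),
    (∀ g ∈ gs, ∀ a (i : Fin n), g.args a = .inl i → x i = x' i) → transcript x vals gs = transcript x' vals gs
  | [], vals, _ => rfl
  | g :: gs, vals, h => by
    rw [transcript_cons, transcript_cons]
    have hg : gateValue x vals g = gateValue x' vals g := by
      unfold gateValue
      congr 1
      funext a
      cases ha : g.args a with
      | inl i => exact h g (by simp) a i ha
      | inr m => rfl
    rw [hg]
    exact transcript_congr_reads gs _ fun g' hg' => h g' (List.mem_cons_of_mem _ hg')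

/-- **A circuit only reads its read wires**: inputs that agree on `readsC C` give the same output. [folklore] -/
theorem eval_congr_reads (C : Circuit (Fin n)) {x x' : Fin n → Bool} (h : ∀ i : Fin n, i.val ∈ readsC C → x i = x' i) :
    C.eval x = C.eval x' := by
  rw [eval_eq_wireVal, eval_eq_wireVal, transcript_congr_reads C.gates [] fun g hg a i ha => h i ?_]
  · cases ho : C.output with
    | inl i =>
      simp only [wireVal]
      exact h i (by rw [readsC, ho]; simp [inlIdx])
    | inr m => rfl
  · rw [readsC, List.mem_append, List.mem_flatMap]
    refine Or.inl ⟨g, hg, ?_⟩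
    rw [readsG, List.mem_flatMap]
    exact ⟨g.args a, List.mem_ofFn.2 ⟨a, rfl⟩, by rw [ha]; simp [inlIdx]⟩

/-- The read wires of circuit `t` are read wires of the instance. [folklore] -/
theorem mem_occList_of_mem_readsC (I : KForrelationInstance) (t : Fin I.k) {v : ℕ} (h : v ∈ readsC (I.C t)) : v ∈ occList I := by
  rw [occList, List.mem_flatMap]
  exact ⟨_, List.mem_ofFn.2 ⟨t, rfl⟩, h⟩

end Reads


end ForrMem

end Literature.Computability.QuantumComplexity
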